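import Literature.Geometry.Riemannian.ParallelTransportCorners
import Literature.Geometry.Riemannian.ExpMapEnergyTaylor
import Literature.Geometry.Riemannian.ExpMapLiftAlgebra
import Literature.Geometry.Lorentzian.MetricDetComparison
import Literature.Geometry.Symplectic.QuaternionLeftMultiplication
import Mathlib.Analysis.SpecialFunctions.Sqrt
import HarnessLib

/-!
# A smooth orthonormal frame along a curve whose first vector is the unit tangent

Topic `Literature/Geometry/Riemannian`.  On a Riemannian `4`-manifold (arbitrary model with
corners, `dim E = 4`), let `γ : ℝ → M` be a `C^∞` curve, regular on `(a, b)`.  Then along `γ`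
there are `C^∞` fields `ν₀, ν₁, ν₂, ν₃`, orthonormal at every `t ∈ (a, b)`, with
`ν₀ = γ' / |γ'|` the unit tangent (`exists_orthonormal_frame_unitTangent`).  In particular
`ν₁, ν₂, ν₃` is a smooth orthonormal frame of the NORMAL bundle of `γ` — the frame along an
embedded circle from which a tubular neighbourhood map `(θ, x) ↦ exp_{γ θ}(∑ xᵢ νᵢ(θ))` is
built (Lee, *Introduction to Riemannian Manifolds* (2018), Thm. 5.25 and Prop. 5.26 (normal
exponential map / Fermi coordinates); used for the zero circles of near-symplectic forms,
Honda 2004 / Perutz 2006, `Literature/Geometry/Symplectic`).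

Construction (O'Neill 1983, Ch. 3, Lemma 3.20 + quaternions): take a PARALLEL orthonormal frame
`p₀, …, p₃` along `γ` (`exists_parallel_orthonormal_frame_smooth`); the coefficient vector
`u(t) ∈ S³ ⊂ ℝ⁴` of the unit tangent in this frame is smooth, and left quaternion multiplication
`L_{u(t)}` is a smooth family in `SO(4)` with first column `u(t)`
(`QuaternionLeftMultiplication.lean`); `νₐ := ∑ⱼ (L_u eₐ)ⱼ pⱼ`.  No topology of the normal
bundle enters (every orientable bundle over an interval is trivial, but here even the explicit
frame is canonical given `p`).  Everything is proved; no definitions, no named facts.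

## References

* B. O'Neill, *Semi-Riemannian geometry*, Academic Press (1983), Ch. 3, Lemma 3.20. [ONeill1983]
* J. M. Lee, *Introduction to Riemannian Manifolds*, 2nd ed., GTM 176 (2018), Thm. 4.32,
  Prop. 5.26. [LeeRiemannianManifolds2018]
-/

noncomputable section

open Bundle Set Filter Function Module
open scoped Manifold ContDiff Topology RealInnerProductSpace

namespace Literature.Geometry.Riemannian

open Literature.Geometry.Lorentzian Literature.Geometry.Symplectic

variable {E : Type*} [NormedAddCommGroup E] [NormedSpace ℝ E]
  {H : Type*} [TopologicalSpace H] {I : ModelWithCorners ℝ E H}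
  {M : Type*} [TopologicalSpace M] [ChartedSpace H M] [IsManifold I ∞ M]

/-! ### Sums of smooth lifts along a map, at a point -/

section LiftSum

variable {EN : Type*} [NormedAddCommGroup EN] [NormedSpace ℝ EN] {HN : Type*} [TopologicalSpace HN]
  {J : ModelWithCorners ℝ EN HN} {N : Type*} [TopologicalSpace N] [ChartedSpace HN N]

/-- **Finite sums of lifts along a map which are `C^k` at a point are `C^k` there**
(`contMDiffAt_liftAlong_add`, induction; the empty sum is the zero section along the base map).
[folklore] -/
theorem contMDiffAt_liftAlong_sum {k : ℕ∞ω} {ι : Type*} (s : Finset ι) {c : N → M} {a₀ : N}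
    (hc : ContMDiffAt J I k c a₀) {Z : ι → Π a : N, TangentSpace I (c a)}
    (hZ : ∀ i ∈ s, ContMDiffAt J I.tangent k
      (fun a ↦ (TotalSpace.mk' E (c a) (Z i a) : TangentBundle I M)) a₀) :
    ContMDiffAt J I.tangent k
      (fun a ↦ (TotalSpace.mk' E (c a) (∑ i ∈ s, Z i a) : TangentBundle I M)) a₀ := by
  classical
  induction s using Finset.induction_on with
  | empty =>
    simp only [Finset.sum_empty]
    exact ((contMDiff_zeroSection ℝ (TangentSpace I : M → Type _)).contMDiffAt.of_le le_top).comp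
      a₀ hc
  | insert i s hi ih =>
    have h := contMDiffAt_liftAlong_add (hZ i (Finset.mem_insert_self i s))
      (ih fun j hj ↦ hZ j (Finset.mem_insert_of_mem hj))
    refine h.congr_of_eventuallyEq (Eventually.of_forall fun a ↦ ?_)
    simp only [Finset.sum_insert hi]

/-- Smooth coefficients times lifts: `a ↦ (c a, ∑ᵢ fᵢ(a) Zᵢ(a))` is `C^k` at `a₀` when the `fᵢ`
and the lifts of the `Zᵢ` are. [folklore] -/
theorem contMDiffAt_liftAlong_sum_smul {k : ℕ∞ω} {ι : Type*} [Fintype ι] {c : N → M} {a₀ : N}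
    (hc : ContMDiffAt J I k c a₀) {Z : ι → Π a : N, TangentSpace I (c a)} {f : ι → N → ℝ}
    (hZ : ∀ i, ContMDiffAt J I.tangent k
      (fun a ↦ (TotalSpace.mk' E (c a) (Z i a) : TangentBundle I M)) a₀)
    (hf : ∀ i, ContMDiffAt J 𝓘(ℝ, ℝ) k (f i) a₀) :
    ContMDiffAt J I.tangent k
      (fun a ↦ (TotalSpace.mk' E (c a) (∑ i, f i a • Z i a) : TangentBundle I M)) a₀ :=
  contMDiffAt_liftAlong_sum Finset.univ hc fun i _ ↦ contMDiffAt_liftAlong_smul (hZ i) (hf i)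

end LiftSum

/-! ### Orthonormal expansions for a bundle metric -/

section Metric

variable {n : ℕ∞ω} (g : PseudoRiemannianMetric I n E (TangentSpace I : M → Type _))

/-- `g(∑ xᵢ eᵢ, ∑ yⱼ eⱼ) = ∑ xᵢ yᵢ` for a `g_x`-orthonormal family `e`. [folklore] -/
theorem val_sum_smul_sum_smul {ι : Type*} [Fintype ι] [DecidableEq ι] {x : M}
    {e : ι → TangentSpace I x} (hon : ∀ i j, g.val x (e i) (e j) = if i = j then 1 else 0)
    (xv yv : ι → ℝ) :
    g.val x (∑ i, xv i • e i) (∑ j, yv j • e j) = ∑ i, xv i * yv i := by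
  simp only [map_sum, map_smul, FunLike.coe_sum, FunLike.coe_smul, Finset.sum_apply,
    Pi.smul_apply, smul_eq_mul, hon, mul_ite, mul_one, mul_zero, Finset.sum_ite_eq',
    Finset.mem_univ, if_true]
  exact Finset.sum_congr rfl fun i _ ↦ mul_comm _ _

/-- A `g_x`-orthonormal family is linearly independent. [folklore] -/
theorem linearIndependent_of_val_orthonormal {ι : Type*} [Fintype ι] [DecidableEq ι] {x : M}
    {e : ι → TangentSpace I x} (hon : ∀ i j, g.val x (e i) (e j) = if i = j then 1 else 0) :
    LinearIndependent ℝ e := by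
  rw [Fintype.linearIndependent_iff]
  intro c hc i
  have h := congrArg (fun w ↦ g.val x w (e i)) hc
  simp only [map_sum, map_smul, FunLike.coe_sum, FunLike.coe_smul, Finset.sum_apply,
    Pi.smul_apply, smul_eq_mul, hon, mul_ite, mul_one, mul_zero, Finset.sum_ite_eq',
    Finset.mem_univ, if_true, map_zero] at h
  exact h

variable [FiniteDimensional ℝ E]

/-- **Expansion in an orthonormal frame**: if `e : ι → T_xM` is `g_x`-orthonormal with
`card ι = dim M`, then `v = ∑ᵢ g(v, eᵢ) eᵢ` (nondegeneracy of `g_x`). [folklore] -/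
theorem eq_sum_val_smul {ι : Type*} [Fintype ι] [DecidableEq ι] {x : M}
    {e : ι → TangentSpace I x} (hon : ∀ i j, g.val x (e i) (e j) = if i = j then 1 else 0)
    (hcard : Fintype.card ι = finrank ℝ E) (v : TangentSpace I x) :
    v = ∑ i, g.val x v (e i) • e i := by
  have hli := linearIndependent_of_val_orthonormal g hon
  haveI : FiniteDimensional ℝ (TangentSpace I x) := (inferInstance : FiniteDimensional ℝ E)
  have hcard' : Fintype.card ι = finrank ℝ (TangentSpace I x) := hcard
  -- `e` is a basis of `T_xM = E`
  have hsp : ⊤ ≤ Submodule.span ℝ (Set.range e) :=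
    (hli.span_eq_top_of_card_eq_finrank' hcard').ge
  set B : Basis ι ℝ (TangentSpace I x) := Basis.mk hli hsp with hB
  have hBe : ∀ i, B i = e i := fun i ↦ Basis.mk_apply hli hsp i
  -- `w := v - ∑ g(v, eᵢ) eᵢ` is `g`-orthogonal to every `eⱼ`, hence to everything
  set w : TangentSpace I x := v - ∑ i, g.val x v (e i) • e i with hw
  have hwe : ∀ j, g.val x w (e j) = 0 := fun j ↦ by
    simp only [hw, map_sub, map_sum, map_smul, FunLike.coe_sub, FunLike.coe_sum,
      FunLike.coe_smul, Pi.sub_apply, Finset.sum_apply, Pi.smul_apply, smul_eq_mul, hon, mul_ite,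
      mul_one, mul_zero, Finset.sum_ite_eq', Finset.mem_univ, if_true, sub_self]
  have hw0 : w = 0 := by
    refine g.nondegenerate x w fun u ↦ ?_
    have hu : u = ∑ i, B.repr u i • e i := by
      conv_lhs => rw [← B.sum_repr u]
      simp only [hBe]
    rw [hu, map_sum]
    simp only [map_smul, smul_eq_mul, hwe, mul_zero, Finset.sum_const_zero]
  exact (sub_eq_zero.1 hw0)

end Metric

/-! ### The frame -/

section Frame

variable [FiniteDimensional ℝ E] [CompleteSpace E]
  {cov : CovariantDerivative I E (TangentSpace I : M → Type _)}
  (g : PseudoRiemannianMetric I ∞ E (TangentSpace I : M → Type _))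

/-- `⟪x, y⟫ = ∑ xᵢ yᵢ` on `ℝ⁴`. [folklore] -/
theorem inner_E4_eq_sum (x y : EuclideanSpace ℝ (Fin 4)) : ⟪x, y⟫ = ∑ i, x i * y i := by
  simp only [PiLp.inner_apply, RCLike.inner_apply, conj_trivial, mul_comm]

/-- **A smooth orthonormal frame along a regular curve with first vector the unit tangent**
(O'Neill 1983, Ch. 3, Lemma 3.20, combined with left quaternion multiplication on the
coefficients in a parallel frame): on a Riemannian `4`-manifold with a metric-compatible, locally
`C^∞` covariant derivative, for a `C^∞` curve `γ` with `γ' ≠ 0` on `(a, b) ∋ t₀` there are fields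
`ν₀, …, ν₃` along `γ`, `g`-orthonormal and with `C^∞` lifts at every `t ∈ (a, b)`, such that
`ν₀(t) = γ'(t) / |γ'(t)|`. [cite: ONeill1983, Ch. 3, Lemma 3.20] -/
theorem exists_orthonormal_frame_unitTangent (hg : g.IsRiemannian) (hcov : g.IsCompatible cov)
    (hreg : cov.IsLocallyContMDiff ∞) (hE : finrank ℝ E = 4) {γ : ℝ → M}
    (hγ : ContMDiff 𝓘(ℝ, ℝ) I ∞ γ) {a b t₀ : ℝ} (ht₀ : t₀ ∈ Ioo a b)
    (hvel : ∀ t ∈ Ioo a b, velocity I γ t ≠ 0) :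
    ∃ ν : Fin 4 → Π t : ℝ, TangentSpace I (γ t),
      (∀ t ∈ Ioo a b, ∀ i j, g.val (γ t) (ν i t) (ν j t) = if i = j then 1 else 0) ∧
      (∀ i, ∀ t ∈ Ioo a b, ContMDiffAt 𝓘(ℝ, ℝ) I.tangent ∞
        (fun t' ↦ (TotalSpace.mk' E (γ t') (ν i t') : TangentBundle I M)) t) ∧
      ∀ t ∈ Ioo a b, ν 0 t =
        (Real.sqrt (g.val (γ t) (velocity I γ t) (velocity I γ t)))⁻¹ • velocity I γ t := by
  classical
  haveI : Fact ((1 : ℕ∞ω) ≤ ∞) := ⟨by exact_mod_cast le_top⟩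
  -- (1) an orthonormal basis at `γ t₀`, reindexed by `Fin 4`, and its parallel extension
  obtain ⟨b₀, hb₀⟩ := g.exists_orthonormal_basis (γ t₀) hg
  have hE' : finrank ℝ (TangentSpace I (γ t₀)) = 4 := hE
  set v : Fin 4 → TangentSpace I (γ t₀) := fun i ↦ b₀ ((finCongr hE').symm i) with hv
  have hvon : ∀ i j, g.val (γ t₀) (v i) (v j) = if i = j then 1 else 0 := fun i j ↦ by
    rw [hv, hb₀]
    simp only [EmbeddingLike.apply_eq_iff_eq]
  obtain ⟨p, -, -, hps, hpon⟩ :=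
    exists_parallel_orthonormal_frame_smooth g hg hcov hreg hγ ht₀ v hvon
  have hcard : Fintype.card (Fin 4) = finrank ℝ E := by rw [Fintype.card_fin, hE]
  -- (2) coefficients of the velocity in the parallel frame
  set cf : Fin 4 → ℝ → ℝ := fun j t ↦ g.val (γ t) (velocity I γ t) (p j t) with hcf
  have hvel_eq : ∀ t ∈ Ioo a b, velocity I γ t = ∑ j, cf j t • p j t := fun t ht ↦
    eq_sum_val_smul g (hpon t ht) hcard _
  set nf : ℝ → ℝ := fun t ↦ Real.sqrt (∑ j, cf j t ^ 2) with hnf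
  have hgvv : ∀ t ∈ Ioo a b, g.val (γ t) (velocity I γ t) (velocity I γ t) = ∑ j, cf j t ^ 2 := by
    intro t ht
    conv_lhs => rw [hvel_eq t ht]
    rw [val_sum_smul_sum_smul g (hpon t ht)]
    simp only [pow_two]
  have hsum_pos : ∀ t ∈ Ioo a b, 0 < ∑ j, cf j t ^ 2 := fun t ht ↦ by
    rw [← hgvv t ht]; exact hg _ _ (hvel t ht)
  have hnf_pos : ∀ t ∈ Ioo a b, 0 < nf t := fun t ht ↦ Real.sqrt_pos.2 (hsum_pos t ht)
  have hnf_eq : ∀ t ∈ Ioo a b,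
      nf t = Real.sqrt (g.val (γ t) (velocity I γ t) (velocity I γ t)) := fun t ht ↦ by
    rw [hnf, hgvv t ht]
  -- the unit coefficient vector `u(t) ∈ S³`
  set uf : ℝ → EuclideanSpace ℝ (Fin 4) := fun t ↦ WithLp.toLp 2 fun j ↦ cf j t / nf t
    with huf
  have huf_apply : ∀ t j, uf t j = cf j t / nf t := fun t j ↦ rfl
  have huf_norm : ∀ t ∈ Ioo a b, ‖uf t‖ = 1 := by
    intro t ht
    have h1 : ‖uf t‖ ^ 2 = 1 := by
      rw [← real_inner_self_eq_norm_sq, inner_E4_eq_sum]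
      have h2 : ∀ j, uf t j * uf t j = cf j t ^ 2 / nf t ^ 2 := fun j ↦ by
        rw [huf_apply, div_mul_div_comm, ← pow_two, ← pow_two]
      simp only [h2, ← Finset.sum_div]
      show (∑ j, cf j t ^ 2) / Real.sqrt (∑ j, cf j t ^ 2) ^ 2 = 1
      rw [Real.sq_sqrt (hsum_pos t ht).le, div_self (hsum_pos t ht).ne']
    nlinarith [norm_nonneg (uf t)]
  -- (3) the frame
  set ν : Fin 4 → Π t : ℝ, TangentSpace I (γ t) :=
    fun i t ↦ ∑ j, (quatLeftMul (uf t) (stdVec i)) j • p j t with hν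
  refine ⟨ν, fun t ht i j ↦ ?_, fun i t ht ↦ ?_, fun t ht ↦ ?_⟩
  · -- orthonormality
    show g.val (γ t) (∑ k, (quatLeftMul (uf t) (stdVec i)) k • p k t)
      (∑ k, (quatLeftMul (uf t) (stdVec j)) k • p k t) = _
    rw [val_sum_smul_sum_smul g (hpon t ht), ← inner_E4_eq_sum,
      inner_quatLeftMul_stdVec (huf_norm t ht)]
  · -- smoothness of the lift at `t ∈ (a, b)`
    show ContMDiffAt 𝓘(ℝ, ℝ) I.tangent ∞ (fun t' ↦ (TotalSpace.mk' E (γ t')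
      (∑ j, (quatLeftMul (uf t') (stdVec i)) j • p j t') : TangentBundle I M)) t
    -- the coefficient functions are `C^∞` at `t`
    have hcf_sm : ∀ j, ContMDiffAt 𝓘(ℝ, ℝ) 𝓘(ℝ, ℝ) ∞ (cf j) t := fun j ↦
      contMDiffAt_val_apply_along g le_rfl ((contMDiff_lift_velocity_of_contMDiff hγ) t)
        (hps j t ht)
    have hcf_sm' : ∀ j, ContDiffAt ℝ ∞ (cf j) t := fun j ↦
      contMDiffAt_iff_contDiffAt.1 (hcf_sm j)
    have hsum_sm : ContDiffAt ℝ ∞ (fun t' ↦ ∑ j, cf j t' ^ 2) t :=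
      ContDiffAt.sum fun j _ ↦ (hcf_sm' j).pow 2
    have hnf_sm : ContDiffAt ℝ ∞ nf t := hsum_sm.sqrt (hsum_pos t ht).ne'
    have huf_sm : ∀ j, ContDiffAt ℝ ∞ (fun t' ↦ uf t' j) t := fun j ↦ by
      simp only [huf_apply]
      exact (hcf_sm' j).div hnf_sm (hnf_pos t ht).ne'
    have hq_sm : ∀ j, ContMDiffAt 𝓘(ℝ, ℝ) 𝓘(ℝ, ℝ) ∞
        (fun t' ↦ (quatLeftMul (uf t') (stdVec i)) j) t := by
      intro j
      rw [contMDiffAt_iff_contDiffAt]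
      have h0 := huf_sm 0; have h1 := huf_sm 1; have h2 := huf_sm 2; have h3 := huf_sm 3
      fin_cases j
      · show ContDiffAt ℝ ∞ (fun t' ↦ (quatLeftMul (uf t') (stdVec i)) 0) t
        simp only [quatLeftMul_apply_zero]; fun_prop
      · show ContDiffAt ℝ ∞ (fun t' ↦ (quatLeftMul (uf t') (stdVec i)) 1) t
        simp only [quatLeftMul_apply_one]; fun_prop
      · show ContDiffAt ℝ ∞ (fun t' ↦ (quatLeftMul (uf t') (stdVec i)) 2) t
        simp only [quatLeftMul_apply_two]; fun_prop
      · show ContDiffAt ℝ ∞ (fun t' ↦ (quatLeftMul (uf t') (stdVec i)) 3) t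
        simp only [quatLeftMul_apply_three]; fun_prop
    exact contMDiffAt_liftAlong_sum_smul (hγ t) (fun j ↦ hps j t ht) hq_sm
  · -- `ν₀ = γ' / |γ'|`
    show ∑ j, (quatLeftMul (uf t) (stdVec 0)) j • p j t = _
    simp only [quatLeftMul_stdVec_zero, huf_apply, div_eq_inv_mul, mul_smul, ← Finset.smul_sum]
    rw [← hvel_eq t ht, hnf_eq t ht]

end Frame

end Literature.Geometry.Riemannian

end
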